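import Summits.NavierStokesRegularity.NavierStokesRegularity.Theses.AxisymmetricExtremality
import Summits.NavierStokesRegularity.NavierStokesRegularity.Theorems.AxisymmetricExtremalityAxisymmetricKatoGlobalStubSereginLogSwirlOriginStep3LocalFamilies
import Literature.Analysis.FluidPDE.WholeSpaceIBP
import Literature.Analysis.FluidPDE.NewtonKernel
import HarnessLib

/-!
# Seregin 2022, §2 Step 3 for the LOCAL smooth class (IX): uniform-in-`x` time moduli of the
# vorticity right-hand side `W = νΔω − Dω[u] + Du[ω]` of a family of smooth fields —
# crux stmt-NavierStokesRegularity-15453 (`AxisymmetricExtremality.AxisymmetricKatoGlobal`), line registered, support for stub `stub_sereginLogSwirlOrigin`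

Support file (`--supports stmt-NavierStokesRegularity-15453`; theorems only, everything proved)
toward the registered stub `stub_sereginLogSwirlOrigin` = the named fact
`Literature.Analysis.FluidPDE.seregin2022_logSwirl_regularAtOrigin` (G. Seregin, J. Math. Fluid
Mech. 24 (2022), Paper 27 = arXiv:2201.00153, §2), sequel of `…Step3LocalFamilies`. In the port
of Step 3 to the local Seregin–Zajaczkowski class the time derivatives of `Γ = ω_θ/r`,
`Φ = ω_r/r` are the quotients `angVelQuot W`, `radVelQuot W` of the vorticity right-hand side
`W = νΔω − Dω[u] + Du[ω]` (`…Step3LocalEquations(Phi)`), and the key estimate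
(`cutoff_energy_keyEstimate_local_unconditional`) needs their joint continuity on the slab. By
`continuousOn_radQuot_family` this follows from uniform-in-`x` time moduli of the `x`-derivatives
of `swirl W`, `⟪x_h, W⟫`; this file derives the moduli of `W` itself from those of `u` (all
orders) for a family with smooth slices supported in a fixed ball:

* `unifTime_fderiv`, `unifTime_add`, `unifTime_sub`, `unifTime_const_smul` — the moduli pass
  to the gradient family and through linear combinations;
* `norm_iteratedFDeriv_laplacian_le`, `unifTime_laplacian` — `‖Dᵏ Δφ‖ ≤ 3‖Dᵏ⁺²φ‖`
  (`Δφ = Σᵢ ∂ᵢ∂ᵢφ`, `norm_iteratedFDeriv_clm_apply_fderiv_le` twice) and the moduli of `Δu`;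
* `fderiv_eq_zero_of_forall_norm_gt`, `curl_eq_zero_of_forall_norm_gt` — support bookkeeping;
* `unifTime_vorticityRHS` (registered sub-goal) — **the moduli of `W(t) = νΔ(curl u t) −
  D(curl u t)[u t] + D(u t)[curl u t]`**, all orders (`unifTime_curl`, `unifTime_laplacian`,
  `unifTime_bilinear` with the evaluation pairing for the two products).

## Mathlib / tree search

Tree: `unifTime_curl`, `unifTime_bilinear`, `unifTime_mono_order` (`…Step3LocalFamilies`),
`norm_iteratedFDeriv_clm_apply_fderiv_le`, `natCast_le_contDiff_infty` (`KNSSThm52Assembly`),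
`laplacian_eq_sum_fderiv_fderiv` (`WholeSpaceIBP`), `contDiff_laplacian` (`NewtonKernel`).
Mathlib: `iteratedFDeriv_fun_sum_apply`, `iteratedFDeriv_add_apply`, `iteratedFDeriv_const_smul_apply`,
`norm_iteratedFDeriv_fderiv`, `ContDiffAt.laplacian_sub`, `laplacian_const`,
`Filter.EventuallyEq.fderiv_eq`. `lean search 'unifTime_vorticityRHS|unifTime_laplacian' --decl`:
no matches (2026-08-17).

## References

* G. Seregin, J. Math. Fluid Mech. 24 (2022), Paper No. 27 = arXiv:2201.00153, §2 Step 3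
  (arXiv pp. 6–7). [`Seregin2022LocalAxisym`]
-/

noncomputable section

open MeasureTheory Set Filter Topology Function Metric
open scoped ContDiff RealInnerProductSpace Laplacian
open Literature.Analysis.FluidPDE

-- `<Problem> = <Summit>` duplicates a namespace component by design (lakefile sets the same option).
set_option linter.dupNamespace false

namespace Summit.NavierStokesRegularity.NavierStokesRegularity.Theorems.AxisymmetricKatoGlobal.EulerScaling

section Linear

variable {S : Set ℝ} {F : Type*} [NormedAddCommGroup F] [NormedSpace ℝ F]

/-- **The moduli pass to the gradient family** (`‖Dᵏ(Df)‖ = ‖Dᵏ⁺¹f‖`). [folklore] -/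
theorem unifTime_fderiv {u : ℝ → EuclideanSpace ℝ (Fin 3) → F} (hu : ∀ t ∈ S, ContDiff ℝ ∞ (u t))
    (hU : ∀ k : ℕ, ∀ t ∈ S, ∀ ε > 0, ∃ δ > 0, ∀ t' ∈ S, |t' - t| < δ → ∀ y,
      ‖iteratedFDeriv ℝ k (u t') y - iteratedFDeriv ℝ k (u t) y‖ ≤ ε) :
    ∀ k : ℕ, ∀ t ∈ S, ∀ ε > 0, ∃ δ > 0, ∀ t' ∈ S, |t' - t| < δ → ∀ y,
      ‖iteratedFDeriv ℝ k (fderiv ℝ (u t')) y - iteratedFDeriv ℝ k (fderiv ℝ (u t)) y‖ ≤ ε := by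
  intro k t ht ε hε
  obtain ⟨δ, hδ, h⟩ := hU (k + 1) t ht ε hε
  refine ⟨δ, hδ, fun t' ht' hlt y => ?_⟩
  have hsubf : fderiv ℝ (u t') - fderiv ℝ (u t) = fderiv ℝ (u t' - u t) := by
    funext z
    rw [Pi.sub_apply, fderiv_sub (((hu t' ht').differentiable (by simp)) z) (((hu t ht).differentiable (by simp)) z)]
  have hD : ∀ s ∈ S, ContDiff ℝ k (fderiv ℝ (u s)) := fun s hs =>
    (hu s hs).fderiv_right (m := k) (by exact_mod_cast le_top)
  rw [← iteratedFDeriv_sub_apply (hD t' ht').contDiffAt (hD t ht).contDiffAt, hsubf,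
    norm_iteratedFDeriv_fderiv, iteratedFDeriv_sub_apply ((hu t' ht').of_le (natCast_le_contDiff_infty _)).contDiffAt
      ((hu t ht).of_le (natCast_le_contDiff_infty _)).contDiffAt]
  exact h t' ht' hlt y

/-- Moduli of a sum of two families. [folklore] -/
theorem unifTime_add {f g : ℝ → EuclideanSpace ℝ (Fin 3) → F} (hf : ∀ t ∈ S, ContDiff ℝ ∞ (f t))
    (hg : ∀ t ∈ S, ContDiff ℝ ∞ (g t))
    (hUf : ∀ k : ℕ, ∀ t ∈ S, ∀ ε > 0, ∃ δ > 0, ∀ t' ∈ S, |t' - t| < δ → ∀ y,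
      ‖iteratedFDeriv ℝ k (f t') y - iteratedFDeriv ℝ k (f t) y‖ ≤ ε)
    (hUg : ∀ k : ℕ, ∀ t ∈ S, ∀ ε > 0, ∃ δ > 0, ∀ t' ∈ S, |t' - t| < δ → ∀ y,
      ‖iteratedFDeriv ℝ k (g t') y - iteratedFDeriv ℝ k (g t) y‖ ≤ ε) :
    ∀ k : ℕ, ∀ t ∈ S, ∀ ε > 0, ∃ δ > 0, ∀ t' ∈ S, |t' - t| < δ → ∀ y,
      ‖iteratedFDeriv ℝ k (fun y => f t' y + g t' y) y - iteratedFDeriv ℝ k (fun y => f t y + g t y) y‖ ≤ ε := by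
  intro k t ht ε hε
  obtain ⟨δ₁, hδ₁, h₁⟩ := hUf k t ht (ε / 2) (half_pos hε)
  obtain ⟨δ₂, hδ₂, h₂⟩ := hUg k t ht (ε / 2) (half_pos hε)
  refine ⟨min δ₁ δ₂, lt_min hδ₁ hδ₂, fun t' ht' hlt y => ?_⟩
  have hc : ∀ s ∈ S, ∀ {φ : ℝ → EuclideanSpace ℝ (Fin 3) → F}, (∀ t ∈ S, ContDiff ℝ ∞ (φ t)) →
      ContDiffAt ℝ k (φ s) y := fun s hs φ hφ => ((hφ s hs).of_le (natCast_le_contDiff_infty _)).contDiffAt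
  rw [show (fun y => f t' y + g t' y) = f t' + g t' from rfl, show (fun y => f t y + g t y) = f t + g t from rfl,
    iteratedFDeriv_add_apply (hc t' ht' hf) (hc t' ht' hg), iteratedFDeriv_add_apply (hc t ht hf) (hc t ht hg)]
  calc ‖iteratedFDeriv ℝ k (f t') y + iteratedFDeriv ℝ k (g t') y - (iteratedFDeriv ℝ k (f t) y + iteratedFDeriv ℝ k (g t) y)‖
      = ‖(iteratedFDeriv ℝ k (f t') y - iteratedFDeriv ℝ k (f t) y) + (iteratedFDeriv ℝ k (g t') y - iteratedFDeriv ℝ k (g t) y)‖ := by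
        congr 1; abel
    _ ≤ ε / 2 + ε / 2 := (norm_add_le _ _).trans (add_le_add (h₁ t' ht' (hlt.trans_le (min_le_left _ _)) y)
        (h₂ t' ht' (hlt.trans_le (min_le_right _ _)) y))
    _ = ε := add_halves ε

/-- Moduli of a scalar multiple of a family. [folklore] -/
theorem unifTime_const_smul {f : ℝ → EuclideanSpace ℝ (Fin 3) → F} (hf : ∀ t ∈ S, ContDiff ℝ ∞ (f t))
    (hUf : ∀ k : ℕ, ∀ t ∈ S, ∀ ε > 0, ∃ δ > 0, ∀ t' ∈ S, |t' - t| < δ → ∀ y,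
      ‖iteratedFDeriv ℝ k (f t') y - iteratedFDeriv ℝ k (f t) y‖ ≤ ε) (c : ℝ) :
    ∀ k : ℕ, ∀ t ∈ S, ∀ ε > 0, ∃ δ > 0, ∀ t' ∈ S, |t' - t| < δ → ∀ y,
      ‖iteratedFDeriv ℝ k (fun y => c • f t' y) y - iteratedFDeriv ℝ k (fun y => c • f t y) y‖ ≤ ε := by
  intro k t ht ε hε
  obtain ⟨δ, hδ, h⟩ := hUf k t ht (ε / (|c| + 1)) (by positivity)
  refine ⟨δ, hδ, fun t' ht' hlt y => ?_⟩
  have hc : ∀ s ∈ S, ContDiffAt ℝ k (f s) y := fun s hs => ((hf s hs).of_le (natCast_le_contDiff_infty _)).contDiffAt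
  rw [show (fun y => c • f t' y) = c • f t' from rfl, show (fun y => c • f t y) = c • f t from rfl,
    iteratedFDeriv_const_smul_apply (hc t' ht'), iteratedFDeriv_const_smul_apply (hc t ht), ← smul_sub,
    norm_smul, Real.norm_eq_abs]
  calc |c| * ‖iteratedFDeriv ℝ k (f t') y - iteratedFDeriv ℝ k (f t) y‖ ≤ |c| * (ε / (|c| + 1)) :=
        mul_le_mul_of_nonneg_left (h t' ht' hlt y) (abs_nonneg c)
    _ ≤ ε := by rw [mul_div_assoc', div_le_iff₀ (by positivity)]; nlinarith [abs_nonneg c]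

/-- Moduli of a difference of two families. [folklore] -/
theorem unifTime_sub {f g : ℝ → EuclideanSpace ℝ (Fin 3) → F} (hf : ∀ t ∈ S, ContDiff ℝ ∞ (f t))
    (hg : ∀ t ∈ S, ContDiff ℝ ∞ (g t))
    (hUf : ∀ k : ℕ, ∀ t ∈ S, ∀ ε > 0, ∃ δ > 0, ∀ t' ∈ S, |t' - t| < δ → ∀ y,
      ‖iteratedFDeriv ℝ k (f t') y - iteratedFDeriv ℝ k (f t) y‖ ≤ ε)
    (hUg : ∀ k : ℕ, ∀ t ∈ S, ∀ ε > 0, ∃ δ > 0, ∀ t' ∈ S, |t' - t| < δ → ∀ y,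
      ‖iteratedFDeriv ℝ k (g t') y - iteratedFDeriv ℝ k (g t) y‖ ≤ ε) :
    ∀ k : ℕ, ∀ t ∈ S, ∀ ε > 0, ∃ δ > 0, ∀ t' ∈ S, |t' - t| < δ → ∀ y,
      ‖iteratedFDeriv ℝ k (fun y => f t' y - g t' y) y - iteratedFDeriv ℝ k (fun y => f t y - g t y) y‖ ≤ ε := by
  intro k t ht ε hε
  obtain ⟨δ₁, hδ₁, h₁⟩ := hUf k t ht (ε / 2) (half_pos hε)
  obtain ⟨δ₂, hδ₂, h₂⟩ := hUg k t ht (ε / 2) (half_pos hε)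
  refine ⟨min δ₁ δ₂, lt_min hδ₁ hδ₂, fun t' ht' hlt y => ?_⟩
  have hc : ∀ s ∈ S, ∀ {φ : ℝ → EuclideanSpace ℝ (Fin 3) → F}, (∀ t ∈ S, ContDiff ℝ ∞ (φ t)) →
      ContDiffAt ℝ k (φ s) y := fun s hs φ hφ => ((hφ s hs).of_le (natCast_le_contDiff_infty _)).contDiffAt
  rw [show (fun y => f t' y - g t' y) = f t' - g t' from rfl, show (fun y => f t y - g t y) = f t - g t from rfl,
    iteratedFDeriv_sub_apply (hc t' ht' hf) (hc t' ht' hg), iteratedFDeriv_sub_apply (hc t ht hf) (hc t ht hg)]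
  calc ‖iteratedFDeriv ℝ k (f t') y - iteratedFDeriv ℝ k (g t') y - (iteratedFDeriv ℝ k (f t) y - iteratedFDeriv ℝ k (g t) y)‖
      = ‖(iteratedFDeriv ℝ k (f t') y - iteratedFDeriv ℝ k (f t) y) - (iteratedFDeriv ℝ k (g t') y - iteratedFDeriv ℝ k (g t) y)‖ := by
        congr 1; abel
    _ ≤ ε / 2 + ε / 2 := (norm_sub_le _ _).trans (add_le_add (h₁ t' ht' (hlt.trans_le (min_le_left _ _)) y)
        (h₂ t' ht' (hlt.trans_le (min_le_right _ _)) y))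
    _ = ε := add_halves ε

end Linear

section Laplace

variable {S : Set ℝ}

/-- **`‖Dᵏ Δφ‖ ≤ 3 ‖Dᵏ⁺² φ‖`** for smooth vector fields on `ℝ³`: `Δφ = Σᵢ ∂ᵢ∂ᵢφ` and
`‖Dᵏ(Λ ∘ Dψ)‖ ≤ ‖Λ‖‖Dᵏ⁺¹ψ‖` twice with the evaluations `Λ = ev_{eᵢ}`. [folklore] -/
theorem norm_iteratedFDeriv_laplacian_le {φ : EuclideanSpace ℝ (Fin 3) → EuclideanSpace ℝ (Fin 3)} (hφ : ContDiff ℝ ∞ φ)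
    (k : ℕ) (y : EuclideanSpace ℝ (Fin 3)) :
    ‖iteratedFDeriv ℝ k (Δ φ) y‖ ≤ 3 * ‖iteratedFDeriv ℝ (k + 2) φ y‖ := by
  have hφ2 : ContDiff ℝ 2 φ := hφ.of_le (by norm_cast)
  have hrep : Δ φ = fun x => ∑ i, fderiv ℝ (fun z => fderiv ℝ φ z (stdOrthonormalBasis ℝ (EuclideanSpace ℝ (Fin 3)) i)) x
      (stdOrthonormalBasis ℝ (EuclideanSpace ℝ (Fin 3)) i) :=
    funext fun x => laplacian_eq_sum_fderiv_fderiv _ hφ2 x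
  have hψ : ∀ i, ContDiff ℝ ∞ fun z => fderiv ℝ φ z (stdOrthonormalBasis ℝ (EuclideanSpace ℝ (Fin 3)) i) :=
    fun i => contDiff_infty_fderiv_apply hφ _
  have hg : ∀ i, ContDiff ℝ ∞ fun x => fderiv ℝ (fun z => fderiv ℝ φ z (stdOrthonormalBasis ℝ (EuclideanSpace ℝ (Fin 3)) i)) x
      (stdOrthonormalBasis ℝ (EuclideanSpace ℝ (Fin 3)) i) := fun i => contDiff_infty_fderiv_apply (hψ i) _
  have hbi : ∀ i, ‖stdOrthonormalBasis ℝ (EuclideanSpace ℝ (Fin 3)) i‖ = 1 := fun i =>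
    (stdOrthonormalBasis ℝ (EuclideanSpace ℝ (Fin 3))).orthonormal.1 i
  have hΛ : ∀ i, ‖ContinuousLinearMap.apply ℝ (EuclideanSpace ℝ (Fin 3)) (stdOrthonormalBasis ℝ (EuclideanSpace ℝ (Fin 3)) i)‖ ≤ 1 := fun i => by
    refine ContinuousLinearMap.opNorm_le_bound _ zero_le_one fun L => ?_
    rw [ContinuousLinearMap.apply_apply, one_mul]
    simpa [hbi i] using L.le_opNorm (stdOrthonormalBasis ℝ (EuclideanSpace ℝ (Fin 3)) i)
  have hterm : ∀ i, ‖iteratedFDeriv ℝ k (fun x => fderiv ℝ (fun z => fderiv ℝ φ z (stdOrthonormalBasis ℝ (EuclideanSpace ℝ (Fin 3)) i)) x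
      (stdOrthonormalBasis ℝ (EuclideanSpace ℝ (Fin 3)) i)) y‖ ≤ ‖iteratedFDeriv ℝ (k + 2) φ y‖ := by
    intro i
    have h1 := norm_iteratedFDeriv_clm_apply_fderiv_le
      (ContinuousLinearMap.apply ℝ (EuclideanSpace ℝ (Fin 3)) (stdOrthonormalBasis ℝ (EuclideanSpace ℝ (Fin 3)) i)) (hψ i) k y
    have h2 := norm_iteratedFDeriv_clm_apply_fderiv_le
      (ContinuousLinearMap.apply ℝ (EuclideanSpace ℝ (Fin 3)) (stdOrthonormalBasis ℝ (EuclideanSpace ℝ (Fin 3)) i)) hφ (k + 1) y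
    simp only [ContinuousLinearMap.apply_apply] at h1 h2
    have n0 : 0 ≤ ‖iteratedFDeriv ℝ (k + 1 + 1) φ y‖ := norm_nonneg _
    calc _ ≤ _ := h1
      _ ≤ 1 * (1 * ‖iteratedFDeriv ℝ (k + 1 + 1) φ y‖) :=
          mul_le_mul (hΛ i) (h2.trans (mul_le_mul_of_nonneg_right (hΛ i) n0)) (norm_nonneg _) zero_le_one
      _ = ‖iteratedFDeriv ℝ (k + 2) φ y‖ := by ring_nf
  rw [hrep, iteratedFDeriv_fun_sum_apply fun i _ => ((hg i).of_le (natCast_le_contDiff_infty _)).contDiffAt]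
  refine (norm_sum_le _ _).trans ((Finset.sum_le_sum fun i _ => hterm i).trans ?_)
  rw [Finset.sum_const, Finset.card_univ, Fintype.card_fin, finrank_euclideanSpace_fin, nsmul_eq_mul]
  norm_num

/-- **The moduli pass to the Laplacian family.** [folklore] -/
theorem unifTime_laplacian {u : ℝ → EuclideanSpace ℝ (Fin 3) → EuclideanSpace ℝ (Fin 3)}
    (hu : ∀ t ∈ S, ContDiff ℝ ∞ (u t))
    (hU : ∀ k : ℕ, ∀ t ∈ S, ∀ ε > 0, ∃ δ > 0, ∀ t' ∈ S, |t' - t| < δ → ∀ y,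
      ‖iteratedFDeriv ℝ k (u t') y - iteratedFDeriv ℝ k (u t) y‖ ≤ ε) :
    ∀ k : ℕ, ∀ t ∈ S, ∀ ε > 0, ∃ δ > 0, ∀ t' ∈ S, |t' - t| < δ → ∀ y,
      ‖iteratedFDeriv ℝ k (Δ (u t')) y - iteratedFDeriv ℝ k (Δ (u t)) y‖ ≤ ε := by
  intro k t ht ε hε
  obtain ⟨δ, hδ, h⟩ := hU (k + 2) t ht (ε / 3) (by positivity)
  refine ⟨δ, hδ, fun t' ht' hlt y => ?_⟩
  have hd : ContDiff ℝ ∞ (u t' - u t) := (hu t' ht').sub (hu t ht)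
  have hΔsub : Δ (u t') - Δ (u t) = Δ (u t' - u t) := by
    funext z
    exact (ContDiffAt.laplacian_sub ((hu t' ht').of_le (by norm_cast)).contDiffAt
      ((hu t ht).of_le (by norm_cast)).contDiffAt).symm
  have hΔ : ∀ s ∈ S, ContDiff ℝ k (Δ (u s)) := fun s hs =>
    (contDiff_laplacian (n := ⊤) (by exact_mod_cast hu s hs)).of_le (by exact_mod_cast le_top)
  rw [← iteratedFDeriv_sub_apply (hΔ t' ht').contDiffAt (hΔ t ht).contDiffAt, hΔsub]
  refine (norm_iteratedFDeriv_laplacian_le hd k y).trans ?_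
  rw [iteratedFDeriv_sub_apply ((hu t' ht').of_le (natCast_le_contDiff_infty _)).contDiffAt
    ((hu t ht).of_le (natCast_le_contDiff_infty _)).contDiffAt]
  linarith [h t' ht' hlt y]

end Laplace

section Support

variable {F : Type*} [NormedAddCommGroup F] [NormedSpace ℝ F]

/-- A field vanishing off a ball has vanishing gradient there. [folklore] -/
theorem fderiv_eq_zero_of_forall_norm_gt {f : EuclideanSpace ℝ (Fin 3) → F} {R : ℝ}
    (h : ∀ y, R < ‖y‖ → f y = 0) {y : EuclideanSpace ℝ (Fin 3)} (hy : R < ‖y‖) : fderiv ℝ f y = 0 := by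
  have hev : f =ᶠ[𝓝 y] fun _ => (0 : F) := by
    filter_upwards [(isOpen_lt continuous_const continuous_norm).mem_nhds hy] with z hz using h z hz
  rw [hev.fderiv_eq, fderiv_const_apply]

/-- A field vanishing off a ball has vanishing curl there. [folklore] -/
theorem curl_eq_zero_of_forall_norm_gt {f : EuclideanSpace ℝ (Fin 3) → EuclideanSpace ℝ (Fin 3)} {R : ℝ}
    (h : ∀ y, R < ‖y‖ → f y = 0) {y : EuclideanSpace ℝ (Fin 3)} (hy : R < ‖y‖) : curl f y = 0 := by
  show curlCLM (fderiv ℝ f y) = 0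
  rw [fderiv_eq_zero_of_forall_norm_gt h hy, map_zero]

end Support

section RHS

variable {S : Set ℝ}

/-- **Uniform-in-`x` time moduli of the vorticity right-hand side
`W(t) = νΔ(curl u t) − D(curl u t)[u t] + D(u t)[curl u t]`** of a family `u` with smooth slices
supported in a fixed ball `B̄(0, R)` and moduli of all `x`-derivatives on `S`: for every order `k`,
`‖DᵏW(t', y) − DᵏW(t, y)‖ ≤ ε` for `|t' − t| < δ`, all `y`. (`unifTime_curl`, `unifTime_laplacian`,
and `unifTime_bilinear` with the evaluation pairing `(L, v) ↦ L v` for `Dω[u]`, `Du[ω]`.) This is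
the time regularity of `∂ₜω` available for the cut-off globalisation `χV` of the
Seregin–Zajaczkowski representative; with `continuousOn_radQuot_family` it yields the joint
continuity of `∂ₜΓ = angVelQuot W`, `∂ₜΦ = radVelQuot W` required by the local key estimate.
Registered sub-goal toward `stub_sereginLogSwirlOrigin`. [folklore] -/
theorem unifTime_vorticityRHS : ∀ (S : Set ℝ) (u : ℝ → EuclideanSpace ℝ (Fin 3) → EuclideanSpace ℝ (Fin 3)) (ν R : ℝ), (∀ t ∈ S, ContDiff ℝ (⊤ : ℕ∞) (u t)) → (∀ t ∈ S, ∀ y, R < ‖y‖ → u t y = 0) → (∀ k : ℕ, ∀ t ∈ S, ∀ ε > 0, ∃ δ > 0, ∀ t' ∈ S, |t' - t| < δ → ∀ y, ‖iteratedFDeriv ℝ k (u t') y - iteratedFDeriv ℝ k (u t) y‖ ≤ ε) → ∀ k : ℕ, ∀ t ∈ S, ∀ ε > 0, ∃ δ > 0, ∀ t' ∈ S, |t' - t| < δ → ∀ y, ‖iteratedFDeriv ℝ k (fun y => ν • (Δ (curl (u t'))) y - fderiv ℝ (curl (u t')) y (u t' y) + fderiv ℝ (u t') y (curl (u t') y))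 y - iteratedFDeriv ℝ k (fun y => ν • (Δ (curl (u t))) y - fderiv ℝ (curl (u t)) y (u t y) + fderiv ℝ (u t) y (curl (u t) y)) y‖ ≤ ε := by
  intro S u ν R hu hR hU
  have hω : ∀ t ∈ S, ContDiff ℝ ∞ (curl (u t)) := fun t ht => contDiff_curl (n := ⊤) (by exact_mod_cast hu t ht)
  have hΔω : ∀ t ∈ S, ContDiff ℝ ∞ (Δ (curl (u t))) := fun t ht =>
    contDiff_laplacian (n := ⊤) (by exact_mod_cast hω t ht)
  have hDω : ∀ t ∈ S, ContDiff ℝ ∞ (fderiv ℝ (curl (u t))) := fun t ht => (hω t ht).fderiv_right (m := ∞) (by simp)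
  have hDu : ∀ t ∈ S, ContDiff ℝ ∞ (fderiv ℝ (u t)) := fun t ht => (hu t ht).fderiv_right (m := ∞) (by simp)
  have hωR : ∀ t ∈ S, ∀ y, R < ‖y‖ → curl (u t) y = 0 := fun t ht y hy => curl_eq_zero_of_forall_norm_gt (hR t ht) hy
  -- moduli of `ω`, `Δω`, `Dω`, `Du`
  have hUω := unifTime_curl hu hU
  have hUΔ := unifTime_laplacian hω hUω
  have hUDω := unifTime_fderiv hω hUω
  have hUDu := unifTime_fderiv hu hU
  -- the two products via the evaluation pairing
  set B : (EuclideanSpace ℝ (Fin 3) →L[ℝ] EuclideanSpace ℝ (Fin 3)) →L[ℝ]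
      EuclideanSpace ℝ (Fin 3) →L[ℝ] EuclideanSpace ℝ (Fin 3) := ContinuousLinearMap.id ℝ _ with hB
  have hP := unifTime_bilinear (S := S) B (f := fun t y => fderiv ℝ (curl (u t)) y) (g := u) hDω hu hR hUDω hU
  have hQ := unifTime_bilinear (S := S) B (f := fun t y => fderiv ℝ (u t) y) (g := fun t y => curl (u t) y)
    hDu hω hωR hUDu hUω
  simp only [hB, ContinuousLinearMap.id_apply] at hP hQ
  -- assemble `ν • Δω − P + Q`
  have hA : ∀ t ∈ S, ContDiff ℝ ∞ fun y => ν • (Δ (curl (u t))) y := fun t ht => (hΔω t ht).const_smul ν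
  have hPs : ∀ t ∈ S, ContDiff ℝ ∞ fun y => fderiv ℝ (curl (u t)) y (u t y) := fun t ht => (hDω t ht).clm_apply (hu t ht)
  have hQs : ∀ t ∈ S, ContDiff ℝ ∞ fun y => fderiv ℝ (u t) y (curl (u t) y) := fun t ht => (hDu t ht).clm_apply (hω t ht)
  have hUA := unifTime_const_smul (S := S) hΔω hUΔ ν
  have h1 := unifTime_sub hA hPs hUA hP
  have hAP : ∀ t ∈ S, ContDiff ℝ ∞ fun y => ν • (Δ (curl (u t))) y - fderiv ℝ (curl (u t)) y (u t y) :=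
    fun t ht => (hA t ht).sub (hPs t ht)
  exact unifTime_add hAP hQs h1 hQ

end RHS

end Summit.NavierStokesRegularity.NavierStokesRegularity.Theorems.AxisymmetricKatoGlobal.EulerScaling

end
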